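import Summits.Parity.BatemanHorn.Theses.RoughValueTransport
import Summits.Parity.BatemanHorn.Theorems.RoughValueTransportRoughValueLawOfRatioLaws
import Summits.Parity.BatemanHorn.Theorems.RoughValueTransportRoughValueLawRatioLawsOfRoughValueLaw
import HarnessLib

/-!
# Route `RoughValueTransport`, crux `RoughValueLaw` (stmt-Parity-11390), line `increment-anchoring`:
# the normal form `RoughValueLaw ↔ S4 ∧ S5`

`--supports` file of the checked skeleton
`Summits/Parity/BatemanHorn/Cruxes/RoughValueLaw/Lines/increment_anchoring.lean`.  It assembles the two
LANDED halves — `roughValueLaw_of_ratioLaws : S4 → S5 → RoughValueLaw`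
(`RoughValueTransportRoughValueLawOfRatioLaws.lean`) and `ratioLaws_of_roughValueLaw : RoughValueLaw → S4 ∧ S5`
(`RoughValueTransportRoughValueLawRatioLawsOfRoughValueLaw.lean`) — into the registered statement
`roughValueLaw_iff_ratioLaws`: the crux `Summit.Parity.BatemanHorn.Theses.RoughValueTransport.RoughValueLaw`
(Buchstab shape of the jointly rough values of every Bateman–Horn system, constant free) is EQUIVALENT to
the conjunction of the line's two open ratio laws, S4 (`Φ_f(x,u)/Φ_f(x,U) → ((uω(u))/(Uω(U)))^k`,
`3 ≤ u < U`, every Buchstab `ω`) and S5 (`Φ_f(x,u)/Φ_f(x,3) → ((1+log(u−1))/(1+log 2))^k`, `2 < u < 3`),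
i.e. to the crux in projective (constant-free, existence-free) coordinates split at depth `u = 3`.
Everything used is PROVED in the tree; no definition and no named fact is introduced.
-/

namespace Summit.Parity.BatemanHorn.Cruxes.RoughValueLaw.IncrementAnchoring

open Filter Finset Polynomial
open scoped Topology BigOperators
open Literature.NumberTheory.Sieve

/-- **Normal form of the crux** (registered statement `roughValueLaw_iff_ratioLaws` of crux
stmt-Parity-11390, line `increment-anchoring`): `RoughValueLaw ↔ S4 ∧ S5` — the Buchstab-shape law for
the rough values of every Bateman–Horn system holds (with some constant) iff the deep rung ratios
(`3 ≤ u < U`) and the shallow rung ratios against the rung `3` (`2 < u < 3`) converge to the Buchstab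
ratios.  From the landed `roughValueLaw_of_ratioLaws` and `ratioLaws_of_roughValueLaw`. [folklore] -/
theorem roughValueLaw_iff_ratioLaws :
    Summit.Parity.BatemanHorn.Theses.RoughValueTransport.RoughValueLaw ↔
    ((∀ (k : ℕ) (f : Fin k → Polynomial ℤ), IsBatemanHornSystem f → ∀ ω : ℝ → ℝ,
      ((∀ u : ℝ, 1 ≤ u → u ≤ 2 → ω u = u⁻¹) ∧ ContinuousOn ω (Set.Ici 1) ∧
        (∀ u : ℝ, 2 < u → HasDerivAt (fun t : ℝ => t * ω t) (ω (u - 1)) u)) →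
      ∀ u U : ℝ, 3 ≤ u → u < U →
        Tendsto (fun x : ℕ =>
          (((Icc 1 x).filter (fun n : ℕ => ∀ i, 0 < (f i).eval (n : ℤ) ∧
              ∀ p ∈ range ⌈(x : ℝ) ^ (((f i).natDegree : ℝ) / u)⌉₊,
                p.Prime → ¬ ((p : ℤ) ∣ (f i).eval (n : ℤ)))).card : ℝ) /
          (((Icc 1 x).filter (fun n : ℕ => ∀ i, 0 < (f i).eval (n : ℤ) ∧
              ∀ p ∈ range ⌈(x : ℝ) ^ (((f i).natDegree : ℝ) / U)⌉₊,
                p.Prime → ¬ ((p : ℤ) ∣ (f i).eval (n : ℤ)))).card : ℝ)) atTop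
          (𝓝 ((u * ω u / (U * ω U)) ^ k))) ∧
    (∀ (k : ℕ) (f : Fin k → Polynomial ℤ), IsBatemanHornSystem f →
      ∀ u : ℝ, 2 < u → u < 3 →
        Tendsto (fun x : ℕ =>
          (((Icc 1 x).filter (fun n : ℕ => ∀ i, 0 < (f i).eval (n : ℤ) ∧
              ∀ p ∈ range ⌈(x : ℝ) ^ (((f i).natDegree : ℝ) / u)⌉₊,
                p.Prime → ¬ ((p : ℤ) ∣ (f i).eval (n : ℤ)))).card : ℝ) /
          (((Icc 1 x).filter (fun n : ℕ => ∀ i, 0 < (f i).eval (n : ℤ) ∧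
              ∀ p ∈ range ⌈(x : ℝ) ^ (((f i).natDegree : ℝ) / 3)⌉₊,
                p.Prime → ¬ ((p : ℤ) ∣ (f i).eval (n : ℤ)))).card : ℝ)) atTop
          (𝓝 (((1 + Real.log (u - 1)) / (1 + Real.log 2)) ^ k)))) :=
  ⟨fun h => ratioLaws_of_roughValueLaw h, fun h => roughValueLaw_of_ratioLaws h.1 h.2⟩

end Summit.Parity.BatemanHorn.Cruxes.RoughValueLaw.IncrementAnchoring
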